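import Literature.AnabelianGeometry.EtaleTheta.ThetaRigidity
import Literature.AnabelianGeometry.EtaleTheta.ThetaSubquotientOfTempered

/-!
# [EtTh] §5: the parameters `(q, ι)` of the theta subquotients AT LEVEL `N`, from the §2 rigid data

Mochizuki, *The étale theta function and its Frobenioid-theoretic manifestations*, Publ. RIMS **45** (2009), §2 p. 45–46 (Prop. 2.12 (i),
"`(l·Δ_Θ) ⊆ (Δ^tp_X)^Θ`"; "`(l·Δ_Θ) ↠ (l·Δ_Θ) ⊗ ℤ/Nℤ ≅ μ_N`") and §5 p. 327 (PDF p. 101) ("these subquotients [`Π^tp_X ↠ (Π^tp_X)^Θ ⊇ l·Δ_Θ`]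
determine subquotients `Aut_D(D) ↠ Aut^Θ_D(D)`; `(l·Δ_Θ)_D ⊆ Aut^Θ_D(D)`"); Def. 5.4 (b), Prop. 5.5 (everything downstream reads
`(l·Δ_Θ)_S ⊗ ℤ/Nℤ`).  [cite: MochizukiEtTh2009, §5 p.327 (PDF p.101)]

abc-iut cell, seat abc-iut-w4-d042 (gen 3), row «MERGE-PLAN row 2 (D) + G-w5d123-2 AT THE GENUINE (Q,P)» (offer O1): abc-iut-L2-t9's
`ThetaSubquotient.thetaSubquotientStub q ι` (`ThetaSubquotientOfTempered.lean`) takes abstract parameters `q : Π →* Q` ("`Π^tp_X ↠ (Π^tp_X)^Θ`")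
and `ι : Λ →* Q` ("`l·Δ_Θ ↪ (Π^tp_X)^Θ`", `Λ` abelian with normal image).  Here they are CONSTRUCTED from abc-iut-L2-t2's §2 interface
`RigidData` (`ThetaRigidity.lean`: `thetaKer`, `lDeltaTheta`, `thetaMod : lDeltaTheta ↠ μ_N` with kernel `thetaKer·(l·Δ_Θ)^N` and the
`χ`-equivariance `thetaMod_conj`) and an identification `ιX : RD.PiX ≃ₜ* Π`, AT LEVEL `N`:

* `RigidData.levelKer` = `K_N := Ker(thetaMod)` read in `Π^tp_X` (= `thetaKer · (l·Δ_Θ)^N`; NORMAL in `Π^tp_X` by `thetaMod_conj` —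
  `map_ker_thetaMod_normal`, `levelKer_eq`), `RigidData.LevelQuot = Π^tp_X / K_N`;
* `RigidData.qN ιX : Π →* Π^tp_X/K_N` and `RigidData.iotaN : μ_N →* Π^tp_X/K_N` (`μ_N ≅ (l·Δ_Θ)/K_N ↪ Π^tp_X/K_N`), with
  `iotaN_thetaMod` (`ι_N (thetaMod g) = [g]`), `iotaN_injective`, `iotaN_range` / `iotaN_range_normal`, and the DICTIONARY
  `qN_ιX_mem_range_iff : q_N (ιX k) ∈ ι_N(μ_N) ↔ k ∈ lDeltaTheta`, `qN_ιX_eq_iotaN_thetaMod`.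

So `Λ := μ_N` is a `CommGroup` by construction, and t9's carrier `(l·Δ_Θ)_E` for `(q_N, ι_N)` is the LEVEL-`N` subquotient
`μ_N / J(Stab)` — DISCLOSED READING: this instantiates the stub's `lDelta` at level `N` ("`(l·Δ_Θ)_S ⊗ ℤ/Nℤ`"), not print's `(l·Δ_Θ)_S` itself;
every typed consumer (`ThetaFrobenioid.lDeltaModN`, `RigidityFamily`, Def. 5.4 (b), `IsKummerDetermined`, `LinearlyReachableFromBN`) reads
`lDelta` only modulo `N`, where the two agree.  The abelian-ness of `(l·Δ_Θ)` itself (`≅ Ẑ(1)`, [EtTh] §1) is not a field of `RigidData`,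
which is why the level-`N` reading is the one constructible from that interface today.  Definitions + kernel-checked lemmas only; nothing
about [EtTh]'s curves is asserted; no side taken on [IUTchIII] Cor. 3.12.
-/

noncomputable section

namespace Literature.AnabelianGeometry.EtaleTheta

namespace RigidData

universe u v

variable {N : ℕ+} {l : ℕ} (RD : RigidData.{u} N l)

/-! ### `K_N = Ker(thetaMod) ⊆ Π^tp_X` and `Q_N = Π^tp_X / K_N` -/

/-- `Ker((l·Δ_Θ) ↠ μ_N)` read in `Π^tp_X` is NORMAL in `Π^tp_X`: `thetaMod` is `χ`-equivariant under conjugation (`thetaMod_conj`, p.46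
"natural").  [cite: MochizukiEtTh2009, §2 p.46] -/
theorem map_ker_thetaMod_normal : (RD.thetaMod.ker.map RD.lDeltaTheta.subtype).Normal := by
  refine ⟨fun a ha x => ?_⟩
  obtain ⟨g, hg, rfl⟩ := ha
  refine ⟨⟨x * g * x⁻¹, RD.lDeltaTheta_normal.conj_mem _ g.2 x⟩, ?_, rfl⟩
  rw [SetLike.mem_coe, MonoidHom.mem_ker] at hg ⊢
  rw [RD.thetaMod_conj x g, hg, map_one]

/-- **`K_N`**: the kernel of `(l·Δ_Θ) ↠ (l·Δ_Θ) ⊗ ℤ/Nℤ ≅ μ_N` read in `Π^tp_X` (= `thetaKer · (l·Δ_Θ)^N`, `thetaMod_ker`), as the normal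
closure of that (already normal) subgroup so that `Π^tp_X / K_N` carries its group structure by instance (reducible, so that Mathlib's
`Subgroup.normalClosure_normal` instance applies).  [cite: MochizukiEtTh2009, §2 p.46] -/
abbrev levelKer : Subgroup RD.PiX :=
  Subgroup.normalClosure ((RD.thetaMod.ker.map RD.lDeltaTheta.subtype : Subgroup RD.PiX) : Set RD.PiX)

/-- `K_N` IS `Ker(thetaMod)` read in `Π^tp_X`. [cite: MochizukiEtTh2009, §2 p.46] -/
theorem levelKer_eq : RD.levelKer = RD.thetaMod.ker.map RD.lDeltaTheta.subtype := by
  haveI := RD.map_ker_thetaMod_normal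
  exact le_antisymm (Subgroup.normalClosure_le_normal subset_rfl) (fun x hx => Subgroup.subset_normalClosure hx)

/-- Membership in `K_N`. [cite: MochizukiEtTh2009, §2 p.46] -/
theorem mem_levelKer_iff (k : RD.PiX) : k ∈ RD.levelKer ↔ ∃ g : RD.lDeltaTheta, RD.thetaMod g = 1 ∧ (g : RD.PiX) = k := by
  rw [levelKer_eq]
  constructor
  · rintro ⟨g, hg, rfl⟩
    exact ⟨g, hg, rfl⟩
  · rintro ⟨g, hg, rfl⟩
    exact ⟨g, hg, rfl⟩

/-- `K_N ≤ (l·Δ_Θ)` (inverse images in `Π^tp_X`). [cite: MochizukiEtTh2009, §2 p.46] -/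
theorem levelKer_le_lDeltaTheta : RD.levelKer ≤ RD.lDeltaTheta := by
  intro k hk
  obtain ⟨g, -, rfl⟩ := (RD.mem_levelKer_iff k).1 hk
  exact g.2

/-- An element of `(l·Δ_Θ)` lies in `K_N` iff `thetaMod` kills it. [cite: MochizukiEtTh2009, §2 p.46] -/
theorem coe_mem_levelKer_iff (g : RD.lDeltaTheta) : (g : RD.PiX) ∈ RD.levelKer ↔ RD.thetaMod g = 1 := by
  rw [mem_levelKer_iff]
  constructor
  · rintro ⟨g', hg', h⟩
    rwa [Subtype.ext h] at hg'
  · intro h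
    exact ⟨g, h, rfl⟩

/-- **`Q_N := Π^tp_X / K_N`** — the level-`N` shadow of `(Π^tp_X)^Θ`. [cite: MochizukiEtTh2009, §2 p.45] -/
abbrev LevelQuot : Type u := RD.PiX ⧸ RD.levelKer

/-! ### `q_N : Π → Q_N` and `ι_N : μ_N → Q_N` -/

variable {G : Type v} [Group G] [TopologicalSpace G] (ιX : RD.PiX ≃ₜ* G)

/-- **`q_N : Π ↠ Q_N`** ("`Π^tp_X ↠ (Π^tp_X)^Θ`" at level `N`), on the tree's tempered group `Π` identified with `RD.PiX` by `ιX`.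
[cite: MochizukiEtTh2009, §5 p.327 (PDF p.101)] -/
def qN : G →* RD.LevelQuot := (QuotientGroup.mk' RD.levelKer).comp ιX.symm.toMulEquiv.toMonoidHom

/-- `q_N (ιX k) = [k]`. [cite: MochizukiEtTh2009, §5 p.327 (PDF p.101)] -/
@[simp] theorem qN_apply_ιX (k : RD.PiX) : RD.qN ιX (ιX k) = ((k : RD.PiX) : RD.LevelQuot) := by
  change QuotientGroup.mk' RD.levelKer (ιX.symm (ιX k)) = _
  rw [ιX.symm_apply_apply]
  rfl

/-- `q_N` is onto. [cite: MochizukiEtTh2009, §5 p.327 (PDF p.101)] -/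
theorem qN_surjective : Function.Surjective (RD.qN ιX) := by
  intro c
  obtain ⟨k, rfl⟩ := QuotientGroup.mk_surjective c
  exact ⟨ιX k, RD.qN_apply_ιX ιX k⟩

/-- The well-definedness of `ι_N`: `Ker(thetaMod)` dies in `Q_N`. [cite: MochizukiEtTh2009, §2 p.46] -/
theorem ker_thetaMod_le_ker : RD.thetaMod.ker ≤ ((QuotientGroup.mk' RD.levelKer).comp RD.lDeltaTheta.subtype).ker := by
  intro g hg
  rw [MonoidHom.mem_ker, MonoidHom.comp_apply, QuotientGroup.mk'_apply, QuotientGroup.eq_one_iff]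
  exact (RD.coe_mem_levelKer_iff g).2 hg

/-- **`ι_N : μ_N → Q_N`** ("`l·Δ_Θ ↪ (Π^tp_X)^Θ`" at level `N`): `μ_N ≅ (l·Δ_Θ)/Ker(thetaMod) → Π^tp_X/K_N`.
[cite: MochizukiEtTh2009, §2 p.46; §5 p.327 (PDF p.101)] -/
def iotaN : RD.mu →* RD.LevelQuot :=
  (QuotientGroup.lift RD.thetaMod.ker ((QuotientGroup.mk' RD.levelKer).comp RD.lDeltaTheta.subtype) RD.ker_thetaMod_le_ker).comp
    (QuotientGroup.quotientKerEquivOfSurjective RD.thetaMod RD.thetaMod_surjective).symm.toMonoidHom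

/-- **`ι_N (thetaMod g) = [g]`** for `g ∈ (l·Δ_Θ)`. [cite: MochizukiEtTh2009, §2 p.46] -/
theorem iotaN_thetaMod (g : RD.lDeltaTheta) : RD.iotaN (RD.thetaMod g) = ((g : RD.PiX) : RD.LevelQuot) := by
  have h : (QuotientGroup.quotientKerEquivOfSurjective RD.thetaMod RD.thetaMod_surjective).symm (RD.thetaMod g) =
      (g : RD.lDeltaTheta ⧸ RD.thetaMod.ker) := by
    rw [MulEquiv.symm_apply_eq]
    rfl
  change QuotientGroup.lift RD.thetaMod.ker _ RD.ker_thetaMod_le_ker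
    ((QuotientGroup.quotientKerEquivOfSurjective RD.thetaMod RD.thetaMod_surjective).symm (RD.thetaMod g)) = _
  rw [h]
  rfl

/-- `ι_N` is injective. [cite: MochizukiEtTh2009, §2 p.46] -/
theorem iotaN_injective : Function.Injective RD.iotaN := by
  rw [injective_iff_map_eq_one]
  intro m hm
  obtain ⟨g, rfl⟩ := RD.thetaMod_surjective m
  rw [iotaN_thetaMod, QuotientGroup.eq_one_iff] at hm
  exact (RD.coe_mem_levelKer_iff g).1 hm

/-- **`ι_N(μ_N) = image of (l·Δ_Θ) in Q_N`.** [cite: MochizukiEtTh2009, §5 p.327 (PDF p.101)] -/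
theorem iotaN_range : RD.iotaN.range = RD.lDeltaTheta.map (QuotientGroup.mk' RD.levelKer) := by
  ext c
  constructor
  · rintro ⟨m, rfl⟩
    obtain ⟨g, rfl⟩ := RD.thetaMod_surjective m
    rw [iotaN_thetaMod]
    exact ⟨g, g.2, rfl⟩
  · rintro ⟨k, hk, rfl⟩
    exact ⟨RD.thetaMod ⟨k, hk⟩, RD.iotaN_thetaMod ⟨k, hk⟩⟩

/-- **`ι_N(μ_N)` is normal in `Q_N`** (`(l·Δ_Θ)` is normal in `Π^tp_X`, `lDeltaTheta_normal`). [cite: MochizukiEtTh2009, §2 p.45] -/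
theorem iotaN_range_normal : RD.iotaN.range.Normal := by
  rw [iotaN_range]
  haveI := RD.lDeltaTheta_normal
  exact Subgroup.Normal.map inferInstance _ (QuotientGroup.mk'_surjective _)

/-- **Dictionary, exact value**: for `k ∈ (l·Δ_Θ)`, `q_N (ιX k) = ι_N (thetaMod k)`. [cite: MochizukiEtTh2009, §5 p.327 (PDF p.101)] -/
theorem qN_ιX_eq_iotaN_thetaMod (k : RD.PiX) (hk : k ∈ RD.lDeltaTheta) :
    RD.qN ιX (ιX k) = RD.iotaN (RD.thetaMod ⟨k, hk⟩) := by
  rw [qN_apply_ιX, iotaN_thetaMod]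

/-- **Dictionary**: `q_N (ιX k) ∈ ι_N(μ_N) ↔ k ∈ (l·Δ_Θ)` (`K_N ≤ (l·Δ_Θ)`). [cite: MochizukiEtTh2009, §5 p.327 (PDF p.101)] -/
theorem qN_ιX_mem_range_iff (k : RD.PiX) : RD.qN ιX (ιX k) ∈ RD.iotaN.range ↔ k ∈ RD.lDeltaTheta := by
  rw [qN_apply_ιX, iotaN_range]
  constructor
  · rintro ⟨g, hg, h⟩
    have h' : g⁻¹ * k ∈ RD.levelKer := by
      rw [← QuotientGroup.eq]
      exact h
    have := RD.lDeltaTheta.mul_mem hg (RD.levelKer_le_lDeltaTheta h')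
    rwa [mul_inv_cancel_left] at this
  · intro hk
    exact ⟨k, hk, rfl⟩

/-- `q_N g ∈ ι_N(μ_N) ↔ ιX⁻¹ g ∈ (l·Δ_Θ)` for `g ∈ Π`. [cite: MochizukiEtTh2009, §5 p.327 (PDF p.101)] -/
theorem qN_mem_range_iff (g : G) : RD.qN ιX g ∈ RD.iotaN.range ↔ ιX.symm g ∈ RD.lDeltaTheta := by
  rw [← RD.qN_ιX_mem_range_iff ιX (ιX.symm g), ιX.apply_symm_apply]

/-! ### The level-`N` theta subquotients over `B^temp(Π)⁰` -/

/-- **The LEVEL-`N` theta subquotients `(l·Δ_Θ ⊗ ℤ/Nℤ)_(−)` over `B^temp(Π)⁰` from the §2 rigid data**: abc-iut-L2-t9's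
`thetaSubquotientStub` at `(q_N, ι_N)` — carrier at `E` = compatible families `E → μ_N` modulo null ones (`≅ μ_N / J(Stab x)`).
[cite: MochizukiEtTh2009, §5 p.327 (PDF p.101)] -/
def levelStub : FrobenioidTheta.ThetaSubquotientStub.{max v u}
    (Literature.AlgebraicGeometry.Frobenioids.ConnectedPart (Literature.AnabelianGeometry.SemiGraphs.BTemp G)) :=
  haveI := RD.iotaN_range_normal
  ThetaSubquotient.thetaSubquotientStub (RD.qN ιX) RD.iotaN

/-- The carrier of `levelStub` at `E` is t9's `LDelta (q_N) (ι_N) E.obj` (definitionally). [cite: MochizukiEtTh2009, §5 p.327 (PDF p.101)] -/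
theorem levelStub_lDelta [RD.iotaN.range.Normal]
    (E : Literature.AlgebraicGeometry.Frobenioids.ConnectedPart (Literature.AnabelianGeometry.SemiGraphs.BTemp G)) :
    (RD.levelStub ιX).lDelta E = ThetaSubquotient.LDelta (RD.qN ιX) RD.iotaN E.obj := rfl

end RigidData

end Literature.AnabelianGeometry.EtaleTheta
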